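import Mathlib.Analysis.Calculus.ContDiff.Bounds
import Mathlib.Analysis.Calculus.IteratedDeriv.Defs
import Mathlib.Algebra.BigOperators.Field
import HarnessLib

/-!
# `δ`-symbol classes: smooth families with derivative bounds `C δ^{-(p+i)} (1 + ‖x‖)^M`

`Literature/Analysis/Calculus/` — bookkeeping of the small-divisor parameter `δ` in KAM-type
perturbation theory, in the form used by W. De Roeck, F. Huveneers, CPAM 68 (2015),
arXiv:1305.5127, §3.2–3.3 and §5.6: there a function `g(·; δ)` is written `g ∼ δ^{-p}` when it is
(a sum of terms) `δ^{-p} b(ω/δ, δ) f(ω)` with `b` smooth, bounded with all its derivatives, and `f`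
with polynomially bounded derivatives ((3.12)–(3.13)); the calculus "`g ∼ δ^{-p}, h ∼ δ^{-m} ⇒
L_g h ∼ δ^{-(p+m+1)}`", "`L_D⁻¹(Id - 𝓡) g ∼ δ^{-(p+1)}`" ((3.14) and its proof) only uses the
resulting DERIVATIVE BOUNDS, which we take as the definition:

* `IsDeltaSymbol p c` for a family `c : ℝ → E → ℝ` (`δ ↦ (x ↦ c δ x)`): for `δ ∈ (0, 1]`, `c δ` is
  `C^∞` and for every order `i` there are `C, M` with
  `‖D^i (c δ)(x)‖ ≤ C δ^{-(p+i)} (1 + ‖x‖)^M` uniformly in `δ ∈ (0,1]`, `x ∈ E`.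

Closure properties (all proved): monotonicity in `p`, constants and continuous linear forms
(class `0`), sums, real multiples, products (`p + p'`, Leibniz bound `norm_iteratedFDeriv_mul_le`),
division by `δ^a` (`p + a`), directional derivatives (`p + 1`), and composition of a smooth function
of one variable with bounded derivatives with a rescaled linear form `x ↦ ρ(ℓ(x)/δ)` (class `0`; this
covers the cut-offs `ρ_δ(k·ω)` of §3.1); extraction of the pointwise bounds of order `0` and `1`.

No named facts. [cite: DeRoeckHuveneers2015, §3.2 (3.12)–(3.13), §3.3 (3.14)]
-/

noncomputable section

open Set Function Finset
open scoped ContDiff Topology BigOperators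

namespace Literature.Analysis.Calculus

variable {E : Type*} [NormedAddCommGroup E] [NormedSpace ℝ E]

/-- Casting a natural order below `∞`. [folklore] -/
theorem natCast_le_infty (i : ℕ) : (i : WithTop ℕ∞) ≤ ∞ := by exact_mod_cast le_top

/-- **`δ`-symbol of order `p`**: a family `c δ : E → ℝ`, `δ ∈ (0,1]`, of smooth functions with
`‖D^i(c δ)(x)‖ ≤ C_i δ^{-(p+i)} (1 + ‖x‖)^{M_i}` for every `i`, uniformly in `δ` and `x`
("`c ∼ δ^{-p}`"). [cite: DeRoeckHuveneers2015, §3.2 (3.12)–(3.13) and §3.3 proof of (3.14)] -/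
def IsDeltaSymbol (p : ℕ) (c : ℝ → E → ℝ) : Prop :=
  (∀ δ : ℝ, 0 < δ → δ ≤ 1 → ContDiff ℝ ∞ (c δ)) ∧
    ∀ i : ℕ, ∃ C : ℝ, ∃ M : ℕ, 0 ≤ C ∧ ∀ δ : ℝ, 0 < δ → δ ≤ 1 → ∀ x : E,
      ‖iteratedFDeriv ℝ i (c δ) x‖ ≤ C / δ ^ (p + i) * (1 + ‖x‖) ^ M

namespace IsDeltaSymbol

variable {p p' : ℕ} {c c' : ℝ → E → ℝ}

/-- Members of a symbol class are smooth. [folklore] -/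
theorem contDiff (h : IsDeltaSymbol p c) {δ : ℝ} (hδ : 0 < δ) (hδ1 : δ ≤ 1) : ContDiff ℝ ∞ (c δ) :=
  h.1 δ hδ hδ1

/-- The derivative bounds of a symbol class. [folklore] -/
theorem bound (h : IsDeltaSymbol p c) (i : ℕ) :
    ∃ C : ℝ, ∃ M : ℕ, 0 ≤ C ∧ ∀ δ : ℝ, 0 < δ → δ ≤ 1 → ∀ x : E,
      ‖iteratedFDeriv ℝ i (c δ) x‖ ≤ C / δ ^ (p + i) * (1 + ‖x‖) ^ M :=
  h.2 i

omit [NormedSpace ℝ E] in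
/-- Elementary: `1 ≤ 1 + ‖x‖`. [folklore] -/
theorem one_le_weight (x : E) : (1 : ℝ) ≤ 1 + ‖x‖ := le_add_of_nonneg_right (norm_nonneg x)

/-- Elementary: for `0 < δ ≤ 1` and `a ≤ b`, `1/δ^a ≤ 1/δ^b`. [folklore] -/
theorem one_div_pow_le_one_div_pow {δ : ℝ} (hδ : 0 < δ) (hδ1 : δ ≤ 1) {a b : ℕ} (hab : a ≤ b) :
    1 / δ ^ a ≤ 1 / δ ^ b :=
  one_div_le_one_div_of_le (pow_pos hδ b) (pow_le_pow_of_le_one hδ.le hδ1 hab)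

/-- **Pointwise bound of order `0`**: `|c δ x| ≤ C δ^{-p} (1 + ‖x‖)^M`. [cite: DeRoeckHuveneers2015, §5.6] -/
theorem norm_le (h : IsDeltaSymbol p c) :
    ∃ C : ℝ, ∃ M : ℕ, 0 ≤ C ∧ ∀ δ : ℝ, 0 < δ → δ ≤ 1 → ∀ x : E,
      ‖c δ x‖ ≤ C / δ ^ p * (1 + ‖x‖) ^ M := by
  obtain ⟨C, M, hC, hb⟩ := h.bound 0
  refine ⟨C, M, hC, fun δ hδ hδ1 x => ?_⟩
  have := hb δ hδ hδ1 x
  rwa [norm_iteratedFDeriv_zero, add_zero] at this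

/-- **Pointwise bound of order `1`**: `|D(c δ)(x)·v| ≤ ‖v‖ C δ^{-(p+1)} (1 + ‖x‖)^M`.
[cite: DeRoeckHuveneers2015, §5.6] -/
theorem norm_fderiv_apply_le (h : IsDeltaSymbol p c) :
    ∃ C : ℝ, ∃ M : ℕ, 0 ≤ C ∧ ∀ δ : ℝ, 0 < δ → δ ≤ 1 → ∀ x v : E,
      ‖fderiv ℝ (c δ) x v‖ ≤ ‖v‖ * (C / δ ^ (p + 1) * (1 + ‖x‖) ^ M) := by
  obtain ⟨C, M, hC, hb⟩ := h.bound 1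
  refine ⟨C, M, hC, fun δ hδ hδ1 x v => ?_⟩
  have h1 : ‖fderiv ℝ (c δ) x‖ ≤ C / δ ^ (p + 1) * (1 + ‖x‖) ^ M := by
    have := hb δ hδ hδ1 x
    rwa [← norm_iteratedFDeriv_fderiv, norm_iteratedFDeriv_zero] at this
  calc ‖fderiv ℝ (c δ) x v‖ ≤ ‖fderiv ℝ (c δ) x‖ * ‖v‖ := ContinuousLinearMap.le_opNorm _ _
    _ ≤ C / δ ^ (p + 1) * (1 + ‖x‖) ^ M * ‖v‖ := by gcongr
    _ = ‖v‖ * (C / δ ^ (p + 1) * (1 + ‖x‖) ^ M) := by ring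

/-! ### Closure properties -/

/-- Monotonicity in the order: `c ∼ δ^{-p} ⇒ c ∼ δ^{-q}` for `p ≤ q` (`δ ≤ 1`). [folklore] -/
theorem mono (h : IsDeltaSymbol p c) {q : ℕ} (hpq : p ≤ q) : IsDeltaSymbol q c := by
  refine ⟨h.1, fun i => ?_⟩
  obtain ⟨C, M, hC, hb⟩ := h.bound i
  refine ⟨C, M, hC, fun δ hδ hδ1 x => (hb δ hδ hδ1 x).trans ?_⟩
  have hw : 0 ≤ (1 + ‖x‖) ^ M := pow_nonneg (zero_le_one.trans (one_le_weight x)) M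
  have : C / δ ^ (p + i) ≤ C / δ ^ (q + i) := by
    rw [div_eq_mul_one_div, div_eq_mul_one_div C]
    exact mul_le_mul_of_nonneg_left (one_div_pow_le_one_div_pow hδ hδ1 (by omega)) hC
  exact mul_le_mul_of_nonneg_right this hw

/-- A `δ`-independent smooth function with polynomially bounded derivatives is a symbol of order
`0` (e.g. polynomials in the coordinates). [folklore] -/
theorem of_bounds {f : E → ℝ} (hf : ContDiff ℝ ∞ f)
    (hb : ∀ i : ℕ, ∃ C : ℝ, ∃ M : ℕ, 0 ≤ C ∧ ∀ x : E, ‖iteratedFDeriv ℝ i f x‖ ≤ C * (1 + ‖x‖) ^ M) :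
    IsDeltaSymbol 0 (fun _ => f) := by
  refine ⟨fun _ _ _ => hf, fun i => ?_⟩
  obtain ⟨C, M, hC, hbi⟩ := hb i
  refine ⟨C, M, hC, fun δ hδ hδ1 x => (hbi x).trans ?_⟩
  have hw : 0 ≤ (1 + ‖x‖) ^ M := pow_nonneg (zero_le_one.trans (one_le_weight x)) M
  refine mul_le_mul_of_nonneg_right ?_ hw
  rw [zero_add, le_div_iff₀ (pow_pos hδ i)]
  exact mul_le_of_le_one_right hC (pow_le_one₀ hδ.le hδ1)

/-- Constants are symbols of order `0`. [folklore] -/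
theorem const (a : ℝ) : IsDeltaSymbol 0 (fun (_ : ℝ) (_ : E) => a) := by
  refine of_bounds contDiff_const fun i => ⟨‖a‖, 0, norm_nonneg a, fun x => ?_⟩
  rcases Nat.eq_zero_or_pos i with rfl | hi
  · simp
  · rw [iteratedFDeriv_const_of_ne hi.ne']
    simp

/-- Continuous linear forms (e.g. the coordinates `ω ↦ ω_y`) are symbols of order `0`. [folklore] -/
theorem clm (L : E →L[ℝ] ℝ) : IsDeltaSymbol 0 (fun (_ : ℝ) => (L : E → ℝ)) := by
  refine of_bounds L.contDiff fun i => ⟨‖L‖, 1, norm_nonneg L, fun x => ?_⟩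
  rcases i with _ | i
  · rw [norm_iteratedFDeriv_zero, pow_one]
    calc ‖L x‖ ≤ ‖L‖ * ‖x‖ := L.le_opNorm x
      _ ≤ ‖L‖ * (1 + ‖x‖) := by gcongr; linarith [norm_nonneg x]
  · have hfd : fderiv ℝ (L : E → ℝ) = fun _ => L := funext fun y => L.fderiv
    rw [← norm_iteratedFDeriv_fderiv, hfd]
    rcases i with _ | i
    · rw [norm_iteratedFDeriv_zero, pow_one]
      exact le_mul_of_one_le_right (norm_nonneg L) (one_le_weight x)
    · rw [iteratedFDeriv_const_of_ne (Nat.succ_ne_zero i)]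
      simp only [Pi.zero_apply, norm_zero, pow_one]
      exact mul_nonneg (norm_nonneg L) (zero_le_one.trans (one_le_weight x))

/-- Sums of symbols of the same order. [folklore] -/
theorem add (h : IsDeltaSymbol p c) (h' : IsDeltaSymbol p c') : IsDeltaSymbol p (fun δ x => c δ x + c' δ x) := by
  refine ⟨fun δ hδ hδ1 => (h.contDiff hδ hδ1).add (h'.contDiff hδ hδ1), fun i => ?_⟩
  obtain ⟨C, M, hC, hb⟩ := h.bound i
  obtain ⟨C', M', hC', hb'⟩ := h'.bound i
  refine ⟨C + C', max M M', add_nonneg hC hC', fun δ hδ hδ1 x => ?_⟩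
  have hw1 := one_le_weight x
  have e : (fun x => c δ x + c' δ x) = c δ + c' δ := rfl
  show ‖iteratedFDeriv ℝ i (fun x => c δ x + c' δ x) x‖ ≤ _
  rw [e, iteratedFDeriv_add ((h.contDiff hδ hδ1).of_le (natCast_le_infty i))
    ((h'.contDiff hδ hδ1).of_le (natCast_le_infty i))]
  calc ‖(iteratedFDeriv ℝ i (c δ) + iteratedFDeriv ℝ i (c' δ)) x‖
      ≤ ‖iteratedFDeriv ℝ i (c δ) x‖ + ‖iteratedFDeriv ℝ i (c' δ) x‖ := norm_add_le _ _
    _ ≤ C / δ ^ (p + i) * (1 + ‖x‖) ^ M + C' / δ ^ (p + i) * (1 + ‖x‖) ^ M' :=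
        add_le_add (hb δ hδ hδ1 x) (hb' δ hδ hδ1 x)
    _ ≤ C / δ ^ (p + i) * (1 + ‖x‖) ^ max M M' + C' / δ ^ (p + i) * (1 + ‖x‖) ^ max M M' :=
        add_le_add
          (mul_le_mul_of_nonneg_left (pow_le_pow_right₀ hw1 (le_max_left _ _))
            (div_nonneg hC (pow_nonneg hδ.le _)))
          (mul_le_mul_of_nonneg_left (pow_le_pow_right₀ hw1 (le_max_right _ _))
            (div_nonneg hC' (pow_nonneg hδ.le _)))
    _ = (C + C') / δ ^ (p + i) * (1 + ‖x‖) ^ max M M' := by ring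

/-- Real multiples of symbols. [folklore] -/
theorem const_mul (h : IsDeltaSymbol p c) (a : ℝ) : IsDeltaSymbol p (fun δ x => a * c δ x) := by
  refine ⟨fun δ hδ hδ1 => contDiff_const.mul (h.contDiff hδ hδ1), fun i => ?_⟩
  obtain ⟨C, M, hC, hb⟩ := h.bound i
  refine ⟨‖a‖ * C, M, mul_nonneg (norm_nonneg a) hC, fun δ hδ hδ1 x => ?_⟩
  have e : (fun x => a * c δ x) = a • c δ := by funext x; simp
  show ‖iteratedFDeriv ℝ i (fun x => a * c δ x) x‖ ≤ _
  rw [e, iteratedFDeriv_const_smul_apply ((h.contDiff hδ hδ1).of_le (natCast_le_infty i)).contDiffAt,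
    norm_smul]
  calc ‖a‖ * ‖iteratedFDeriv ℝ i (c δ) x‖ ≤ ‖a‖ * (C / δ ^ (p + i) * (1 + ‖x‖) ^ M) :=
        mul_le_mul_of_nonneg_left (hb δ hδ hδ1 x) (norm_nonneg a)
    _ = ‖a‖ * C / δ ^ (p + i) * (1 + ‖x‖) ^ M := by ring

/-- Negatives of symbols. [folklore] -/
theorem neg (h : IsDeltaSymbol p c) : IsDeltaSymbol p (fun δ x => -c δ x) := by
  have := h.const_mul (-1)
  simpa using this

/-- Differences of symbols of the same order. [folklore] -/
theorem sub (h : IsDeltaSymbol p c) (h' : IsDeltaSymbol p c') : IsDeltaSymbol p (fun δ x => c δ x - c' δ x) := by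
  have := h.add h'.neg
  simpa [sub_eq_add_neg] using this

/-- The zero family is a symbol of every order. [folklore] -/
theorem zero (p : ℕ) : IsDeltaSymbol p (fun (_ : ℝ) (_ : E) => (0 : ℝ)) :=
  (const 0).mono (Nat.zero_le p)

/-- Finite sums of symbols of the same order. [folklore] -/
theorem sum {ι : Type*} (s : Finset ι) {f : ι → ℝ → E → ℝ} (hf : ∀ j ∈ s, IsDeltaSymbol p (f j)) :
    IsDeltaSymbol p (fun δ x => ∑ j ∈ s, f j δ x) := by
  classical
  induction s using Finset.induction_on with
  | empty => simpa using zero p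
  | insert a s ha ih =>
    have h1 := hf a (mem_insert_self a s)
    have h2 := ih fun j hj => hf j (mem_insert_of_mem hj)
    simpa [sum_insert ha] using h1.add h2

/-- Division by `δ^a` raises the order by `a`. [cite: DeRoeckHuveneers2015, §3.2 (3.12) (the prefactor `δ^{-2(k-1)}`)] -/
theorem div_pow (h : IsDeltaSymbol p c) (a : ℕ) : IsDeltaSymbol (p + a) (fun δ x => c δ x / δ ^ a) := by
  refine ⟨fun δ hδ hδ1 => (h.contDiff hδ hδ1).div_const _, fun i => ?_⟩
  obtain ⟨C, M, hC, hb⟩ := h.bound i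
  refine ⟨C, M, hC, fun δ hδ hδ1 x => ?_⟩
  have e : (fun x => c δ x / δ ^ a) = (δ ^ a)⁻¹ • c δ := by funext x; simp [div_eq_inv_mul]
  show ‖iteratedFDeriv ℝ i (fun x => c δ x / δ ^ a) x‖ ≤ _
  rw [e, iteratedFDeriv_const_smul_apply ((h.contDiff hδ hδ1).of_le (natCast_le_infty i)).contDiffAt,
    norm_smul, norm_inv, norm_pow, Real.norm_of_nonneg hδ.le]
  calc (δ ^ a)⁻¹ * ‖iteratedFDeriv ℝ i (c δ) x‖ ≤ (δ ^ a)⁻¹ * (C / δ ^ (p + i) * (1 + ‖x‖) ^ M) :=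
        mul_le_mul_of_nonneg_left (hb δ hδ hδ1 x) (inv_nonneg.2 (pow_nonneg hδ.le a))
    _ = C / δ ^ (p + a + i) * (1 + ‖x‖) ^ M := by
        rw [show p + a + i = a + (p + i) by ring, pow_add]
        field_simp
        ring

/-- **Directional derivatives raise the order by one**: `c ∼ δ^{-p} ⇒ ∂_v c ∼ δ^{-(p+1)}`.
[cite: DeRoeckHuveneers2015, §3.3 proof of (3.14) ("`L_g h ∼ δ^{-(n+m+1)}`")] -/
theorem fderiv_apply (h : IsDeltaSymbol p c) (v : E) :
    IsDeltaSymbol (p + 1) (fun δ x => fderiv ℝ (c δ) x v) := by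
  refine ⟨fun δ hδ hδ1 => ?_, fun i => ?_⟩
  · exact ((h.contDiff hδ hδ1).fderiv_right (m := ∞) (by simp)).clm_apply contDiff_const
  · obtain ⟨C, M, hC, hb⟩ := h.bound (i + 1)
    refine ⟨‖v‖ * C, M, mul_nonneg (norm_nonneg v) hC, fun δ hδ hδ1 x => ?_⟩
    have hf : ContDiffAt ℝ ∞ (fderiv ℝ (c δ)) x :=
      ((h.contDiff hδ hδ1).fderiv_right (m := ∞) (by simp)).contDiffAt
    show ‖iteratedFDeriv ℝ i (fun x => fderiv ℝ (c δ) x v) x‖ ≤ _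
    calc ‖iteratedFDeriv ℝ i (fun x => fderiv ℝ (c δ) x v) x‖
        ≤ ‖v‖ * ‖iteratedFDeriv ℝ i (fderiv ℝ (c δ)) x‖ :=
          norm_iteratedFDeriv_clm_apply_const hf (natCast_le_infty i)
      _ = ‖v‖ * ‖iteratedFDeriv ℝ (i + 1) (c δ) x‖ := by rw [norm_iteratedFDeriv_fderiv]
      _ ≤ ‖v‖ * (C / δ ^ (p + (i + 1)) * (1 + ‖x‖) ^ M) :=
          mul_le_mul_of_nonneg_left (hb δ hδ hδ1 x) (norm_nonneg v)
      _ = ‖v‖ * C / δ ^ (p + 1 + i) * (1 + ‖x‖) ^ M := by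
          rw [show p + (i + 1) = p + 1 + i by ring]; ring

/-- **Products**: `c ∼ δ^{-p}, c' ∼ δ^{-p'} ⇒ c c' ∼ δ^{-(p+p')}` (Leibniz bound).
[cite: DeRoeckHuveneers2015, §3.3 proof of (3.14)] -/
theorem mul (h : IsDeltaSymbol p c) (h' : IsDeltaSymbol p' c') :
    IsDeltaSymbol (p + p') (fun δ x => c δ x * c' δ x) := by
  refine ⟨fun δ hδ hδ1 => (h.contDiff hδ hδ1).mul (h'.contDiff hδ hδ1), fun i => ?_⟩
  choose C M hC hb using h.bound
  choose C' M' hC' hb' using h'.bound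
  -- uniform weight exponent and constant
  set Mt : ℕ := ∑ j ∈ range (i + 1), (M j + M' (i - j)) with hMt
  set Ct : ℝ := ∑ j ∈ range (i + 1), (i.choose j : ℝ) * C j * C' (i - j) with hCt
  have hCt0 : 0 ≤ Ct := sum_nonneg fun j _ => mul_nonneg (mul_nonneg (Nat.cast_nonneg _) (hC j)) (hC' _)
  refine ⟨Ct, Mt, hCt0, fun δ hδ hδ1 x => ?_⟩
  have hw1 := one_le_weight x
  have hw0 : 0 ≤ 1 + ‖x‖ := zero_le_one.trans hw1
  have hle := norm_iteratedFDeriv_mul_le (h.contDiff hδ hδ1) (h'.contDiff hδ hδ1) x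
    (n := i) (natCast_le_infty i)
  refine hle.trans ?_
  rw [hCt, Finset.sum_div, sum_mul]
  refine sum_le_sum fun j hj => ?_
  have hji : j ≤ i := Nat.lt_succ_iff.1 (mem_range.1 hj)
  have hM : M j + M' (i - j) ≤ Mt := by
    rw [hMt]
    exact single_le_sum (f := fun j => M j + M' (i - j)) (fun _ _ => Nat.zero_le _) hj
  have hb1 := hb j δ hδ hδ1 x
  have hb2 := hb' (i - j) δ hδ hδ1 x
  have hA : 0 ≤ C j / δ ^ (p + j) * (1 + ‖x‖) ^ M j :=
    mul_nonneg (div_nonneg (hC j) (pow_nonneg hδ.le _)) (pow_nonneg hw0 _)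
  calc (i.choose j : ℝ) * ‖iteratedFDeriv ℝ j (c δ) x‖ * ‖iteratedFDeriv ℝ (i - j) (c' δ) x‖
      ≤ (i.choose j : ℝ) * (C j / δ ^ (p + j) * (1 + ‖x‖) ^ M j) *
          (C' (i - j) / δ ^ (p' + (i - j)) * (1 + ‖x‖) ^ M' (i - j)) :=
        mul_le_mul (mul_le_mul_of_nonneg_left hb1 (Nat.cast_nonneg _)) hb2 (norm_nonneg _)
          (mul_nonneg (Nat.cast_nonneg _) hA)
    _ = (i.choose j : ℝ) * C j * C' (i - j) / δ ^ (p + p' + i) * (1 + ‖x‖) ^ (M j + M' (i - j)) := by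
        have e : δ ^ (p + j) * δ ^ (p' + (i - j)) = δ ^ (p + p' + i) := by
          rw [← pow_add]; congr 1; omega
        rw [pow_add (1 + ‖x‖), ← e]
        field_simp
    _ ≤ (i.choose j : ℝ) * C j * C' (i - j) / δ ^ (p + p' + i) * (1 + ‖x‖) ^ Mt :=
        mul_le_mul_of_nonneg_left (pow_le_pow_right₀ hw1 hM)
          (div_nonneg (mul_nonneg (mul_nonneg (Nat.cast_nonneg _) (hC j)) (hC' _)) (pow_nonneg hδ.le _))

/-- **Rescaled cut-offs**: for `ρ : ℝ → ℝ` smooth with all derivatives bounded and a continuous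
linear form `ℓ`, the family `x ↦ ρ(ℓ(x)/δ)` is a symbol of order `0` (each derivative costs
`δ^{-1}`); this covers `ρ_δ(k·ω) = ρ(k·ω/δ)` of §3.1. [cite: DeRoeckHuveneers2015, §3.1 (`ρ_a(x) = ρ(x/a)`) and §3.3 (3.13)] -/
theorem comp_clm_div {ρ : ℝ → ℝ} (hρ : ContDiff ℝ ∞ ρ)
    (hb : ∀ i : ℕ, ∃ B : ℝ, 0 ≤ B ∧ ∀ s : ℝ, ‖iteratedFDeriv ℝ i ρ s‖ ≤ B) (ℓ : E →L[ℝ] ℝ) :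
    IsDeltaSymbol 0 (fun δ x => ρ (ℓ x / δ)) := by
  have hcomp : ∀ δ : ℝ, (fun x => ρ (ℓ x / δ)) = ρ ∘ ((δ⁻¹ • ℓ : E →L[ℝ] ℝ) : E → ℝ) := by
    intro δ; funext x; simp [div_eq_inv_mul]
  refine ⟨fun δ hδ hδ1 => ?_, fun i => ?_⟩
  · show ContDiff ℝ ∞ (fun x => ρ (ℓ x / δ))
    rw [hcomp δ]; exact hρ.comp (δ⁻¹ • ℓ).contDiff
  obtain ⟨B, hB, hbi⟩ := hb i
  refine ⟨B * ‖ℓ‖ ^ i, 0, mul_nonneg hB (pow_nonneg (norm_nonneg _) _), fun δ hδ hδ1 x => ?_⟩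
  show ‖iteratedFDeriv ℝ i (fun x => ρ (ℓ x / δ)) x‖ ≤ _
  rw [hcomp δ, ContinuousLinearMap.iteratedFDeriv_comp_right (δ⁻¹ • ℓ) hρ x (natCast_le_infty i), pow_zero,
    mul_one, zero_add]
  calc ‖(iteratedFDeriv ℝ i ρ ((δ⁻¹ • ℓ) x)).compContinuousLinearMap fun _ => δ⁻¹ • ℓ‖
      ≤ ‖iteratedFDeriv ℝ i ρ ((δ⁻¹ • ℓ) x)‖ * ∏ _j : Fin i, ‖δ⁻¹ • ℓ‖ :=
        ContinuousMultilinearMap.norm_compContinuousLinearMap_le _ _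
    _ ≤ B * ∏ _j : Fin i, ‖δ⁻¹ • ℓ‖ := by
        gcongr
        exact hbi _
    _ = B * (‖ℓ‖ / δ) ^ i := by
        rw [prod_const, Finset.card_univ, Fintype.card_fin, norm_smul, norm_inv, Real.norm_of_nonneg hδ.le,
          div_eq_inv_mul]
    _ = B * ‖ℓ‖ ^ i / δ ^ i := by rw [_root_.div_pow]; ring

end IsDeltaSymbol

end Literature.Analysis.Calculus

end
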